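import Summits.ValiantsHypothesis.ValiantsHypothesis.Theorems.LacunarySymmetroidMatrixDescartesVSQKit
import Summits.ValiantsHypothesis.ValiantsHypothesis.Theorems.LacunarySymmetroidMatrixDescartesVSQDesign

/-!
# `MatrixDescartes` census, `m = 2` row — SIGNS of `det` at the `4K − 6` test points of the all-`K` family (incl. square splitting)

HONEST FRAMING.  Val-V1-extremal engine seat val-v1x-eng-6 (g2), `--supports stmt-ValiantsHypothesis-18050` (helper).  Puts the
dominance kit (`…VSQKit`) and the exponent bookkeeping (`…VSQDesign`) together: for the pencil `letters n B` (`K = n + 2 ≥ 4`,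
`B ≥ 4K²`) the determinant `D = ac − b²` has sign `(−1)^n` at `B^{−1}`, `(−1)^{n+w}` at `B^{2w−1}` (`1 ≤ w ≤ n`), is negative at
the `b`-points `B^{2n+2w−1}` (`1 ≤ w ≤ n`), POSITIVE at the bracketed zero `bz n B w` of `b` between two consecutive `b`-points
(`sign_bz`: there `det = a·c` and `a_n`, `c_0` dominate across the whole bracket — the square-splitting step), positive at
`B^{4n+3}`, of sign `(−1)^w` at `B^{4n+2w+3}` and `(−1)^{n+1}` at `B^{6n+5}`.  The count is assembled in `…VSQLaw`.
Nothing here bears on the crux `MatrixDescartes` (stmt-18050, asymptotic) or on `VP ≠ VNP`.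
[folklore] Viro patchworking / dominance; intermediate value theorem.
-/

set_option linter.dupNamespace false
set_option autoImplicit false

namespace Summit.ValiantsHypothesis.ValiantsHypothesis.Theorems.LacunarySymmetroidMatrixDescartes.VSQ

open scoped BigOperators
open Finset Polynomial

/-! ## 1. The pencil family: symmetry, determinant, base -/

/-- the letters are symmetric. [folklore] -/
theorem letters_isSymm (n : ℕ) (B : ℝ) (l : Fin (n + 2)) : (letters n B l).IsSymm := sym2_isSymm _ _ _ _ _ _ _ l

/-- the pencil determinant evaluates to `D`. [folklore] -/
theorem eval_det_letters (n : ℕ) (B t : ℝ) :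
    ((∑ l, (X : ℝ[X]) ^ dF n l • (letters n B l).map Polynomial.C).det).eval t = D n B t :=
  eval_det_sym2 B _ _ _ _ _ _ (dF n) t

variable {n : ℕ} {B : ℝ}

/-- indices are `≤ n + 1`. [folklore] -/
theorem val_le (l : Fin (n + 2)) : (l : ℕ) ≤ n + 1 := Nat.lt_succ_iff.mp l.isLt

/-- `B ≥ 4K²` gives `B > 1` and `B ≥ 4K`. [folklore] -/
theorem hB_basic (hB : 4 * ((n + 2 : ℕ) : ℝ) ^ 2 ≤ B) : 1 < B ∧ 4 * ((n + 2 : ℕ) : ℝ) ≤ B := by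
  have h1 : (2 : ℝ) ≤ ((n + 2 : ℕ) : ℝ) := by exact_mod_cast (show 2 ≤ n + 2 by omega)
  constructor <;> nlinarith

/-! ## 2. Signs at the explicit points `t = B^x` -/

/-- U-rule at `B^x`, from the exponent bookkeeping. [folklore] -/
theorem D_sign_U (hB : 4 * ((n + 2 : ℕ) : ℝ) ^ 2 ≤ B) (x : ℤ) (la lc : Fin (n + 2)) (E : ℤ)
    (Ha : ∀ l : Fin (n + 2), l ≠ la → ea n l x + 1 ≤ ea n la x)
    (Hc : ∀ l : Fin (n + 2), l ≠ lc → ec n l x + 1 ≤ ec n lc x)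
    (Hb : ∀ l : Fin (n + 2), sbF n l = 0 ∨ eb n l x ≤ E) (Hgap : 2 * E + 1 ≤ ea n la x + ec n lc x) :
    0 < (saF n la * scF n lc) * D n B (B ^ x) := by
  obtain ⟨hB1, -⟩ := hB_basic hB
  have hB0 : 0 < B := lt_trans zero_lt_one hB1
  exact det_pos_of_domU (by omega) hB (zpow_pos hB0 x) (fun l => abs_saR_le n l) (fun l => abs_sbR_le n l)
    (fun l => abs_scR_le n l) (haF n) (hbF n) (hcF n) (dF n) (abs_saR_eq n la) (abs_scR_eq n lc)
    (dom_zpow hB1 _ _ _ x la fun l hl => Or.inr (Ha l hl)) (dom_zpow hB1 _ _ _ x lc fun l hl => Or.inr (Hc l hl))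
    (zpow_pos hB0 E).le (below_zpow hB1 _ _ _ x E Hb) (gapU_zpow hB1 _ _ x E _ _ Hgap)

/-- W-rule at `B^x`, from the exponent bookkeeping. [folklore] -/
theorem D_sign_W (hB : 4 * ((n + 2 : ℕ) : ℝ) ^ 2 ≤ B) (x : ℤ) (lb : Fin (n + 2)) (hlb : |sbF n lb| = 1) (Ea Ec : ℤ)
    (Hb : ∀ l : Fin (n + 2), l ≠ lb → sbF n l = 0 ∨ eb n l x + 1 ≤ eb n lb x)
    (Ha : ∀ l : Fin (n + 2), ea n l x ≤ Ea) (Hc : ∀ l : Fin (n + 2), ec n l x ≤ Ec)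
    (Hgap : Ea + Ec + 1 ≤ 2 * eb n lb x) : D n B (B ^ x) < 0 := by
  obtain ⟨hB1, -⟩ := hB_basic hB
  have hB0 : 0 < B := lt_trans zero_lt_one hB1
  exact det_neg_of_domW (by omega) hB (zpow_pos hB0 x) (fun l => abs_saR_le n l) (fun l => abs_sbR_le n l)
    (fun l => abs_scR_le n l) (haF n) (hbF n) (hcF n) (dF n) hlb (dom_zpow hB1 _ _ _ x lb Hb)
    (zpow_pos hB0 Ea).le (zpow_pos hB0 Ec).le (below_zpow hB1 _ _ _ x Ea fun l => Or.inr (Ha l))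
    (below_zpow hB1 _ _ _ x Ec fun l => Or.inr (Hc l)) (gapW_zpow hB1 _ x Ea Ec _ Hgap)

/-- `b`-terms below `b_1` for `x ≤ 2n + 1`. [folklore] -/
theorem Hb_low (x : ℤ) (hx : x ≤ 2 * (n : ℤ) + 1) (l : Fin (n + 2)) : sbF n l = 0 ∨ eb n l x ≤ eb n 1 x := by
  rcases cases_v (val_le l) with h0 | ⟨h1, h2⟩ | htop
  · exact Or.inl (sbR_off (Or.inl h0))
  · exact Or.inr (eb_low_le h1 h2 hx)
  · exact Or.inl (sbR_off (Or.inr htop))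

/-- `b`-terms below `b_n` for `x ≥ 4n − 1`. [folklore] -/
theorem Hb_high (x : ℤ) (hx : 4 * (n : ℤ) - 1 ≤ x) (l : Fin (n + 2)) : sbF n l = 0 ∨ eb n l x ≤ eb n n x := by
  rcases cases_v (val_le l) with h0 | ⟨h1, h2⟩ | htop
  · exact Or.inl (sbR_off (Or.inl h0))
  · exact Or.inr (eb_top_le h1 h2 hx)
  · exact Or.inl (sbR_off (Or.inr htop))

/-- point `x = −1`: sign `(−1)^n`. [folklore] -/
theorem sign_low (hn : 2 ≤ n) (hB : 4 * ((n + 2 : ℕ) : ℝ) ^ 2 ≤ B) : 0 < (-1 : ℝ) ^ n * D n B (B ^ (-1 : ℤ)) := by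
  have h := D_sign_U hB (-1) 0 0 (eb n 1 (-1))
    (fun l hl => ea_low_dom hn (Nat.one_le_iff_ne_zero.2 fun h => hl (Fin.ext h)) (val_le l))
    (fun l hl => ec_low_dom hn (Nat.one_le_iff_ne_zero.2 fun h => hl (Fin.ext h)) (val_le l) (by omega))
    (Hb_low (-1) (by omega)) (gap_low hn)
  simpa [saF, scF, saR_zero, scR_zero] using h

/-- points `x = 2w − 1`, `1 ≤ w ≤ n`: sign `(−1)^{n+w}`. [folklore] -/
theorem sign_blkA (hn : 2 ≤ n) (hB : 4 * ((n + 2 : ℕ) : ℝ) ^ 2 ≤ B) {w : ℕ} (hw1 : 1 ≤ w) (hwn : w ≤ n) :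
    0 < (-1 : ℝ) ^ (n + w) * D n B (B ^ (2 * (w : ℤ) - 1)) := by
  have hwn' : (w : ℤ) ≤ n := by exact_mod_cast hwn
  have h := D_sign_U hB (2 * (w : ℤ) - 1) ⟨w, by omega⟩ 0 (eb n 1 (2 * (w : ℤ) - 1))
    (fun l hl => ea_blk_dom hn hw1 hwn (val_le l) (fun h => hl (Fin.ext h)))
    (fun l hl => ec_low_dom hn (Nat.one_le_iff_ne_zero.2 fun h => hl (Fin.ext h)) (val_le l) (by linarith))
    (Hb_low _ (by linarith)) (gap_blkA hw1 hwn)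
  simpa [saF, scF, saR_blk hw1 hwn, scR_zero] using h

/-- points `x = 2n + 2w − 1`, `1 ≤ w ≤ n`: `det < 0`. [folklore] -/
theorem sign_W (hn : 2 ≤ n) (hB : 4 * ((n + 2 : ℕ) : ℝ) ^ 2 ≤ B) {w : ℕ} (hw1 : 1 ≤ w) (hwn : w ≤ n) :
    D n B (B ^ (2 * (n : ℤ) + 2 * w - 1)) < 0 := by
  have hw1' : (1 : ℤ) ≤ w := by exact_mod_cast hw1
  refine D_sign_W hB (2 * (n : ℤ) + 2 * w - 1) ⟨w, by omega⟩ (by show |sbR n w| = 1; exact abs_sbR_blk hw1 hwn)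
    (ea n n (2 * (n : ℤ) + 2 * w - 1)) (ec n 0 (2 * (n : ℤ) + 2 * w - 1)) ?_ ?_ ?_ (gap_W hn hw1 hwn)
  · intro l hl
    rcases cases_v (val_le l) with h0 | ⟨h1, h2⟩ | htop
    · exact Or.inl (sbR_off (Or.inl h0))
    · exact Or.inr (eb_blk_dom hw1 hwn h1 h2 (fun h => hl (Fin.ext h)))
    · exact Or.inl (sbR_off (Or.inr htop))
  · intro l
    by_cases hl : (l : ℕ) = n
    · rw [hl]
    · linarith [ea_n_dom hn hw1 hwn (val_le l) hl]
  · intro l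
    by_cases hl : (l : ℕ) = 0
    · rw [hl]
    · linarith [ec_low_dom (x := 2 * (n : ℤ) + 2 * w - 1) hn (Nat.one_le_iff_ne_zero.2 hl) (val_le l) (by linarith)]

/-- point `x = 4n + 3`: `det > 0`. [folklore] -/
theorem sign_mid (hn : 2 ≤ n) (hB : 4 * ((n + 2 : ℕ) : ℝ) ^ 2 ≤ B) : 0 < D n B (B ^ (4 * (n : ℤ) + 3)) := by
  have h := D_sign_U hB (4 * (n : ℤ) + 3) (Fin.last (n + 1)) 0 (eb n n (4 * (n : ℤ) + 3))
    (fun l hl => ea_top_dom hn (by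
        have := val_le l
        have hne : (l : ℕ) ≠ n + 1 := fun h => hl (Fin.ext (by simp [h]))
        omega) le_rfl)
    (fun l hl => ec_low_dom hn (Nat.one_le_iff_ne_zero.2 fun h => hl (Fin.ext h)) (val_le l) le_rfl)
    (Hb_high _ (by linarith)) (gap_mid hn)
  simpa [saF, scF, saR_top, scR_zero] using h

/-- points `x = 4n + 2w + 3`, `1 ≤ w ≤ n`: sign `(−1)^w`. [folklore] -/
theorem sign_blkC (hn : 2 ≤ n) (hB : 4 * ((n + 2 : ℕ) : ℝ) ^ 2 ≤ B) {w : ℕ} (hw1 : 1 ≤ w) (hwn : w ≤ n) :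
    0 < (-1 : ℝ) ^ w * D n B (B ^ (4 * (n : ℤ) + 2 * w + 3)) := by
  have hw1' : (1 : ℤ) ≤ w := by exact_mod_cast hw1
  have h := D_sign_U hB (4 * (n : ℤ) + 2 * w + 3) (Fin.last (n + 1)) ⟨w, by omega⟩ (eb n n (4 * (n : ℤ) + 2 * w + 3))
    (fun l hl => ea_top_dom hn (by
        have := val_le l
        have hne : (l : ℕ) ≠ n + 1 := fun h => hl (Fin.ext (by simp [h]))
        omega) (by linarith))
    (fun l hl => ec_blk_dom hn hw1 hwn (val_le l) (fun h => hl (Fin.ext h)))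
    (Hb_high _ (by linarith)) (gap_blkC hn hw1 hwn)
  simpa [saF, scF, saR_top, scR_blk hw1 hwn] using h

/-- point `x = 6n + 5`: sign `(−1)^{n+1}`. [folklore] -/
theorem sign_top (hn : 2 ≤ n) (hB : 4 * ((n + 2 : ℕ) : ℝ) ^ 2 ≤ B) :
    0 < (-1 : ℝ) ^ (n + 1) * D n B (B ^ (6 * (n : ℤ) + 5)) := by
  have hn' : (2 : ℤ) ≤ n := by exact_mod_cast hn
  have h := D_sign_U hB (6 * (n : ℤ) + 5) (Fin.last (n + 1)) (Fin.last (n + 1)) (eb n n (6 * (n : ℤ) + 5))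
    (fun l hl => ea_top_dom hn (by
        have := val_le l
        have hne : (l : ℕ) ≠ n + 1 := fun h => hl (Fin.ext (by simp [h]))
        omega) (by linarith))
    (fun l hl => ec_top_dom hn (by
        have := val_le l
        have hne : (l : ℕ) ≠ n + 1 := fun h => hl (Fin.ext (by simp [h]))
        omega))
    (Hb_high _ (by linarith)) (gap_top hn)
  simpa [saF, scF, saR_top, scR_top] using h

/-! ## 3. Square splitting: the bracketed zeros of `b` -/

/-- `d` is strictly increasing. [folklore] -/
theorem dF_strictMono (hn : 1 ≤ n) : StrictMono (dF n) := by
  refine Fin.strictMono_iff_lt_succ.2 fun i => ?_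
  have hi : (i : ℕ) ≤ n := by have := i.isLt; omega
  simpa [dF] using dN_lt_succ hn hi

/-- on the bracket `[B^{2n+2w−1}, B^{2n+2w+1}]` (`1 ≤ w ≤ n − 1`) the term `a_n` dominates `a`. [folklore] -/
theorem domA_bracket (hn : 2 ≤ n) (hB : 4 * ((n + 2 : ℕ) : ℝ) ^ 2 ≤ B) {w : ℕ} (hw1 : 1 ≤ w) (hwn : w + 1 ≤ n)
    {t : ℝ} (ht1 : B ^ (2 * (n : ℤ) + 2 * w - 1) ≤ t) (ht2 : t ≤ B ^ (2 * (n : ℤ) + 2 * (w + 1 : ℕ) - 1)) :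
    Dom B (saF n) (haF n) (dF n) t ⟨n, by omega⟩ := by
  obtain ⟨hB1, -⟩ := hB_basic hB
  have hB0 : 0 < B := lt_trans zero_lt_one hB1
  have ht0 : 0 < t := lt_of_lt_of_le (zpow_pos hB0 _) ht1
  have D1 := dom_zpow hB1 (saF n) (haF n) (dF n) (2 * (n : ℤ) + 2 * w - 1) ⟨n, by omega⟩
    (fun l hl => Or.inr (ea_n_dom hn hw1 (by omega) (val_le l) (fun h => hl (Fin.ext h))))
  have D2 := dom_zpow hB1 (saF n) (haF n) (dF n) (2 * (n : ℤ) + 2 * (w + 1 : ℕ) - 1) ⟨n, by omega⟩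
    (fun l hl => Or.inr (ea_n_dom hn (by omega) hwn (val_le l) (fun h => hl (Fin.ext h))))
  intro l hl
  rcases le_or_gt (dF n l) (dF n ⟨n, by omega⟩) with hd | hd
  · rcases D1 l hl with h0 | H
    · exact Or.inl h0
    · exact Or.inr (dom_mono_right hB0 hd (zpow_pos hB0 _) ht1 H)
  · rcases D2 l hl with h0 | H
    · exact Or.inl h0
    · exact Or.inr (dom_mono_left hB0 hd.le ht0 ht2 H)

/-- on the same bracket the term `c_0` dominates `c`. [folklore] -/
theorem domC_bracket (hn : 2 ≤ n) (hB : 4 * ((n + 2 : ℕ) : ℝ) ^ 2 ≤ B) {w : ℕ} (hwn : w + 1 ≤ n)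
    {t : ℝ} (ht0 : 0 < t) (ht2 : t ≤ B ^ (2 * (n : ℤ) + 2 * (w + 1 : ℕ) - 1)) :
    Dom B (scF n) (hcF n) (dF n) t 0 := by
  obtain ⟨hB1, -⟩ := hB_basic hB
  have hB0 : 0 < B := lt_trans zero_lt_one hB1
  have hwn' : (w : ℤ) + 1 ≤ n := by exact_mod_cast hwn
  have D2 := dom_zpow hB1 (scF n) (hcF n) (dF n) (2 * (n : ℤ) + 2 * (w + 1 : ℕ) - 1) 0
    (fun l hl => Or.inr (ec_low_dom hn (Nat.one_le_iff_ne_zero.2 fun h => hl (Fin.ext h)) (val_le l)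
      (by push_cast; linarith)))
  intro l hl
  rcases D2 l hl with h0 | H
  · exact Or.inl h0
  · exact Or.inr (dom_mono_left hB0 ((dF_strictMono (by omega)).monotone (Fin.zero_le _)) ht0 ht2 H)

/-- `s^b_w · b(B^{2n+2w−1}) > 0` at the `b`-points. [folklore] -/
theorem sign_fb (hB : 4 * ((n + 2 : ℕ) : ℝ) ^ 2 ≤ B) {w : ℕ} (hw1 : 1 ≤ w) (hwn : w ≤ n) :
    0 < (-1 : ℝ) ^ (w + 1) * fb n B (B ^ (2 * (n : ℤ) + 2 * w - 1)) := by
  obtain ⟨hB1, hB4⟩ := hB_basic hB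
  have hB0 : 0 < B := lt_trans zero_lt_one hB1
  have hs : sbF n ⟨w, by omega⟩ = (-1) ^ (w + 1) := by show sbR n w = _; rw [sbR_blk hw1 hwn]
  have habs : |sbF n ⟨w, by omega⟩| = 1 := by rw [hs]; simp
  have h := sign_mul_bnom_pos (s := sbF n) hB4 hB0 (fun l => abs_sbR_le n l) (hbF n) (dF n) (zpow_pos hB0 _) habs
    (dom_zpow hB1 (sbF n) (hbF n) (dF n) (2 * (n : ℤ) + 2 * w - 1) ⟨w, by omega⟩ (fun l hl => by
      rcases cases_v (val_le l) with h0 | ⟨h1, h2⟩ | htop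
      · exact Or.inl (sbR_off (Or.inl h0))
      · exact Or.inr (eb_blk_dom hw1 hwn h1 h2 (fun h => hl (Fin.ext h)))
      · exact Or.inl (sbR_off (Or.inr htop))))
  rw [hs] at h
  exact h

/-- `b` changes sign across the bracket. [folklore] -/
theorem fb_sign_change (hB : 4 * ((n + 2 : ℕ) : ℝ) ^ 2 ≤ B) {w : ℕ} (hw1 : 1 ≤ w) (hwn : w + 1 ≤ n) :
    fb n B (B ^ (2 * (n : ℤ) + 2 * w - 1)) * fb n B (B ^ (2 * (n : ℤ) + 2 * (w + 1 : ℕ) - 1)) < 0 := by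
  have h1 := sign_fb hB hw1 (by omega)
  have h2 := sign_fb hB (w := w + 1) (by omega) hwn
  have e : (-1 : ℝ) ^ (w + 1) * (-1 : ℝ) ^ (w + 1 + 1) = -1 := by
    rw [← pow_add, show w + 1 + (w + 1 + 1) = 2 * (w + 1) + 1 by ring, pow_add, pow_mul]; norm_num
  nlinarith [mul_pos h1 h2]

/-- its defining property. [folklore] -/
theorem bz_spec (hB : 4 * ((n + 2 : ℕ) : ℝ) ^ 2 ≤ B) {w : ℕ} (hw1 : 1 ≤ w) (hwn : w + 1 ≤ n) :
    B ^ (2 * (n : ℤ) + 2 * w - 1) < bz n B w ∧ bz n B w < B ^ (2 * (n : ℤ) + 2 * (w + 1 : ℕ) - 1) ∧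
      fb n B (bz n B w) = 0 := by
  obtain ⟨hB1, -⟩ := hB_basic hB
  have h12 : B ^ (2 * (n : ℤ) + 2 * w - 1) < B ^ (2 * (n : ℤ) + 2 * (w + 1 : ℕ) - 1) :=
    zpow_lt_zpow_right₀ hB1 (by push_cast; linarith)
  exact Classical.epsilon_spec (p := fun t => B ^ (2 * (n : ℤ) + 2 * w - 1) < t ∧
      t < B ^ (2 * (n : ℤ) + 2 * (w + 1 : ℕ) - 1) ∧ fb n B t = 0)
    (exists_zero_of_sign_change (continuous_bnom B (sbF n) (hbF n) (dF n)) h12 (fb_sign_change hB hw1 hwn))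

/-- **square splitting**: at the zero of `b` the determinant is `a c > 0`. [folklore] -/
theorem sign_bz (hn : 2 ≤ n) (hB : 4 * ((n + 2 : ℕ) : ℝ) ^ 2 ≤ B) {w : ℕ} (hw1 : 1 ≤ w) (hwn : w + 1 ≤ n) :
    0 < D n B (bz n B w) := by
  obtain ⟨hB1, hB4⟩ := hB_basic hB
  have hB0 : 0 < B := lt_trans zero_lt_one hB1
  obtain ⟨h1, h2, h0⟩ := bz_spec hB hw1 hwn
  have ht0 : 0 < bz n B w := lt_trans (zpow_pos hB0 _) h1
  have ha : 0 < fa n B (bz n B w) :=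
    bnom_pos_of_dom hB4 hB0 (fun l => abs_saR_le n l) (haF n) (dF n) ht0 (l₀ := ⟨n, by omega⟩)
      (by show saR n n = 1; rw [saR_blk (show 1 ≤ n by omega) le_rfl, ← two_mul, pow_mul]; norm_num)
      (domA_bracket hn hB hw1 hwn h1.le h2.le)
  have hc : 0 < fc n B (bz n B w) :=
    bnom_pos_of_dom hB4 hB0 (fun l => abs_scR_le n l) (hcF n) (dF n) ht0 (l₀ := 0)
      (by show scR n 0 = 1; rw [scR_zero]) (domC_bracket hn hB hwn ht0 h2.le)
  unfold D; rw [h0]; nlinarith [mul_pos ha hc]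

end Summit.ValiantsHypothesis.ValiantsHypothesis.Theorems.LacunarySymmetroidMatrixDescartes.VSQ
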